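import Summits.ABC.IUTFork.Cor312Statement
import HarnessLib

/-!
# [IUTchIII] Corollary 3.12, statement side — the Θ-SIDE REDUCTION: `−|log(Θ)|` of a typed setting is bounded above
# by ANY place-by-place bound of its local hull volumes (G1-Θ unit (R) of `HOME/staging/w5/w5-d166/g4/G1-THETA-SHAPES.md`)

PROOF-ONLY record file (D-0012; no definitions, no `Prop` facts) of the abc-iut cell (seat abc-iut-w5-d166, gen 4;
branch C «abc ⇐ S», C-lead ruling C-R3/C-R12: the READ binder `hΘ` of `Conditional/AbcOfS*.lean` — the ONE-SIDED
Θ-side identification «(setting of the datum).negLogTheta ≤ ↑(genuine −|log(Θ)|)» — is to be discharged at an M-level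
real setting by comparing LOCAL hull volumes prime by prime). TAKES NO SIDE on [IUTchIII] Cor. 3.12.

[IUTchIII] Cor. 3.12 (kurims May-2020 manuscript `paper:url-4b091feeb646`, p. 173 l. 43 – p. 174 l. 3) defines
`−|log(Θ)|` as "the procession-normalized mono-analytic log-volume [i.e., where the average is taken over `j ∈ 𝔽_l^⋇` …;
Proposition 3.9, (i), (ii)] of the holomorphic hull of the union of the possible images of a Θ-pilot object", the
global log-volume being the sum of the local ones over `v_ℚ ∈ 𝕍_ℚ` (Prop. 3.9 (iii): "all but finitely many of which
are zero"); [IUTchIV] Thm. 1.10, proof, Step (viii) (kurims Apr-2020 manuscript p. 30): "it suffices to sum over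
`v_ℚ ∈ 𝕍_ℚ` the various local “procession-normalized upper bounds” obtained in Steps (v), (vi), (vii)". In the FROZEN
typing of abc-iut-c312-7 (`Cor312Statement`): `negLogTheta = processionNormalized (fun i => ∑ᶠ v_ℚ, (thetaLocal (i+1) v_ℚ).untopD 0)`
(when `ThetaFinite`, else `⊤`), `processionNormalized v = (∑ i, v i)/ℓ⋆` (abc-iut-L6-t4 `PacketLogVolumes`).

THIS FILE proves the bookkeeping behind Step (viii) ONCE, generically over ANY `Cor312.Setting`:

* `thetaFinite_of_thetaLocal_le` — if every local Θ-volume at a label in `𝔽_l^⋇` is bounded above by a real number and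
  vanishes off a finite set of places of `ℚ`, then `ThetaFinite` ("`−|log(Θ)| ∈ ℝ`", the Corollary's first clause);
* `finsum_thetaLocal_le` — the global sum at one label is at most the finite sum of the local bounds;
* **`negLogTheta_le_of_thetaLocal_le`** — `−|log(Θ)| ≤ ↑(processionNormalized (fun i => ∑_{v_ℚ ∈ T′} b i v_ℚ))`;
* `processionNormalized_sum_comm` — `processionNormalized (fun i => ∑_{v_ℚ ∈ T′} b i v_ℚ) = ∑_{v_ℚ ∈ T′} (1/ℓ⋆)·∑_i b i v_ℚ`
  (the order of summation of abc-iut-S2's genuine number `ThetaVolumeInput.negLogTheta = ∑_{p ∈ T(I)} lnνLp … + arch`,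
  `GenuineLogTheta.lean`, is place-first);
* **`negLogTheta_le_sum_add`** — the form consumed by G1-Θ: with the place-first sum and an extra nonnegative summand
  (the archimedean closed form `archLogTheta = ((l+5)/4)·log π > 0` of [IUTchIV] Step (vii), which the setting's trivial
  archimedean container does not see).

Nothing here computes a hull volume: the per-place bounds `b` are INPUTS (units (A), (V), (U1) of the SHAPES memo).
[claim: Mochizuki2012, status: disputed] for the quoted definitions; [cite: Mochizuki2012, IUTchIV Thm. 1.10 Step (viii) p. 30].
HONEST FRAMING: pure order bookkeeping on the typed `negLogTheta`; nothing asserted or denied about Cor. 3.12;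
typed ≠ proved; instantiated ≠ endorsed.
-/

noncomputable section

namespace Summit.ABC.IUTFork.Cor312.Setting

open Thm311 Literature.IUT.LogThetaLattice

variable {T : ThetaIndex} {S : Situation T} (P : Setting S)

/-- `ℓ⋆ > 0` as a real number (`ℓ⋆ ≥ 2`). [folklore] -/
theorem lstar_cast_pos : (0 : ℝ) < (T.lstar : ℝ) := by
  have := T.two_le_lstar
  exact_mod_cast (by omega : 0 < T.lstar)

/-- A local Θ-volume bounded above by a real number is a real number: `(thetaLocal j v_ℚ).untopD 0` IS that volume and is
at most the bound. [folklore] -/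
theorem untopD_thetaLocal_le {j : T.Label} {vQ : T.VQ} {b : ℝ}
    (h : P.thetaLocal j vQ ≤ ((b : ℝ) : WithTop ℝ)) : (P.thetaLocal j vQ).untopD 0 ≤ b := by
  have hne : P.thetaLocal j vQ ≠ ⊤ := ne_top_of_le_ne_top WithTop.coe_ne_top h
  obtain ⟨x, hx⟩ := WithTop.ne_top_iff_exists.mp hne
  rw [← hx] at h ⊢
  rw [WithTop.untopD_coe]
  exact WithTop.coe_le_coe.mp h

/-- **"`−|log(Θ)| ∈ ℝ`" from local bounds**: if at every label `j ∈ 𝔽_l^⋇` the local Θ-volume vanishes off the finite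
set `T′` of places of `ℚ` and is bounded above by a real number on `T′`, then `ThetaFinite`.
[claim: Mochizuki2012, status: disputed] -/
theorem thetaFinite_of_thetaLocal_le (Tset : Finset T.VQ) (b : Fin T.lstar → T.VQ → ℝ)
    (hzero : ∀ (i : Fin T.lstar) (vQ : T.VQ), vQ ∉ Tset → P.thetaLocal (labelSucc i) vQ = ((0 : ℝ) : WithTop ℝ))
    (hle : ∀ (i : Fin T.lstar), ∀ vQ ∈ Tset, P.thetaLocal (labelSucc i) vQ ≤ ((b i vQ : ℝ) : WithTop ℝ)) :
    P.ThetaFinite := by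
  classical
  refine ⟨fun i vQ => ?_, fun i => ?_⟩
  · by_cases hv : vQ ∈ Tset
    · exact ne_top_of_le_ne_top WithTop.coe_ne_top (hle i vQ hv)
    · rw [hzero i vQ hv]; exact WithTop.coe_ne_top
  · refine (Tset.finite_toSet).subset fun vQ hvQ => ?_
    by_contra hv
    apply hvQ
    show (P.thetaLocal (labelSucc i) vQ).untopD 0 = 0
    rw [hzero i vQ hv, WithTop.untopD_coe]

/-- **The global Θ-volume at one label is at most the sum of the local bounds** ([IUTchIII] Prop. 3.9 (iii): the sum
over `v_ℚ` is a finite sum). [claim: Mochizuki2012, status: disputed] -/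
theorem finsum_thetaLocal_le (Tset : Finset T.VQ) (b : Fin T.lstar → T.VQ → ℝ) (i : Fin T.lstar)
    (hzero : ∀ vQ : T.VQ, vQ ∉ Tset → P.thetaLocal (labelSucc i) vQ = ((0 : ℝ) : WithTop ℝ))
    (hle : ∀ vQ ∈ Tset, P.thetaLocal (labelSucc i) vQ ≤ ((b i vQ : ℝ) : WithTop ℝ)) :
    ∑ᶠ vQ : T.VQ, (P.thetaLocal (labelSucc i) vQ).untopD 0 ≤ ∑ vQ ∈ Tset, b i vQ := by
  classical
  have hsupp : (Function.support fun vQ : T.VQ => (P.thetaLocal (labelSucc i) vQ).untopD 0) ⊆ (Tset : Set T.VQ) := by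
    intro vQ hvQ
    by_contra hv
    apply hvQ
    show (P.thetaLocal (labelSucc i) vQ).untopD 0 = 0
    rw [hzero vQ hv, WithTop.untopD_coe]
  rw [finsum_eq_sum_of_support_subset _ hsupp]
  exact Finset.sum_le_sum fun vQ hvQ => P.untopD_thetaLocal_le (hle vQ hvQ)

/-- **`−|log(Θ)| ≤ ↑(processionNormalized (label ↦ ∑_{v_ℚ ∈ T′} b))`** — the Θ-side reduction, label-first form:
the typed `−|log(Θ)|` of ANY setting is bounded above by the procession-normalized average of ANY family of local
upper bounds with the same finite support ([IUTchIV] Thm. 1.10 Step (viii)). [claim: Mochizuki2012, status: disputed] -/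
theorem negLogTheta_le_of_thetaLocal_le (Tset : Finset T.VQ) (b : Fin T.lstar → T.VQ → ℝ)
    (hzero : ∀ (i : Fin T.lstar) (vQ : T.VQ), vQ ∉ Tset → P.thetaLocal (labelSucc i) vQ = ((0 : ℝ) : WithTop ℝ))
    (hle : ∀ (i : Fin T.lstar), ∀ vQ ∈ Tset, P.thetaLocal (labelSucc i) vQ ≤ ((b i vQ : ℝ) : WithTop ℝ)) :
    P.negLogTheta ≤ ((processionNormalized fun i : Fin T.lstar => ∑ vQ ∈ Tset, b i vQ : ℝ) : WithTop ℝ) := by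
  have hfin : P.ThetaFinite := P.thetaFinite_of_thetaLocal_le Tset b hzero hle
  unfold negLogTheta
  rw [if_pos hfin, WithTop.coe_le_coe]
  unfold processionNormalized
  exact div_le_div_of_nonneg_right
    (Finset.sum_le_sum fun i _ => P.finsum_thetaLocal_le Tset b i (hzero i) (hle i)) (lstar_cast_pos).le

/-- Swapping the procession average with the finite sum over places:
`processionNormalized (i ↦ ∑_{v_ℚ ∈ T′} b i v_ℚ) = ∑_{v_ℚ ∈ T′} (1/ℓ⋆)·∑_i b i v_ℚ` (place-first, as in abc-iut-S2's
`ThetaVolumeInput.negLogThetaNonarch = ∑_{p ∈ T(I)} negLogThetaLoc p`). [folklore] -/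
theorem processionNormalized_sum_comm (Tset : Finset T.VQ) (b : Fin T.lstar → T.VQ → ℝ) :
    processionNormalized (fun i : Fin T.lstar => ∑ vQ ∈ Tset, b i vQ) =
      ∑ vQ ∈ Tset, (1 / (T.lstar : ℝ)) * ∑ i : Fin T.lstar, b i vQ := by
  unfold processionNormalized
  rw [Finset.sum_comm, ← Finset.mul_sum, div_eq_inv_mul, one_div]

/-- **`−|log(Θ)| ≤ ↑(∑_{v_ℚ ∈ T′} (1/ℓ⋆)·∑_i b i v_ℚ + A)` for any `A ≥ 0`** — the Θ-side reduction in the PLACE-FIRST form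
consumed by the G1-Θ comparison with abc-iut-S2's `ThetaVolumeInput.negLogTheta = negLogThetaNonarch + archLogTheta`
(`archLogTheta > 0` is the extra summand `A`; the setting's trivial archimedean container contributes `0`).
[claim: Mochizuki2012, status: disputed] -/
theorem negLogTheta_le_sum_add (Tset : Finset T.VQ) (b : Fin T.lstar → T.VQ → ℝ) {A : ℝ} (hA : 0 ≤ A)
    (hzero : ∀ (i : Fin T.lstar) (vQ : T.VQ), vQ ∉ Tset → P.thetaLocal (labelSucc i) vQ = ((0 : ℝ) : WithTop ℝ))
    (hle : ∀ (i : Fin T.lstar), ∀ vQ ∈ Tset, P.thetaLocal (labelSucc i) vQ ≤ ((b i vQ : ℝ) : WithTop ℝ)) :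
    P.negLogTheta ≤ ((∑ vQ ∈ Tset, (1 / (T.lstar : ℝ)) * ∑ i : Fin T.lstar, b i vQ + A : ℝ) : WithTop ℝ) := by
  refine (P.negLogTheta_le_of_thetaLocal_le Tset b hzero hle).trans ?_
  rw [WithTop.coe_le_coe, processionNormalized_sum_comm]
  exact le_add_of_nonneg_right hA

/-- The same reduction with the local bounds given on ALL places and the vanishing folded into them (`b i v_ℚ = 0` off
`T′` is not required: only `thetaLocal = 0` there); convenient when the bound family is a closed form defined
everywhere (e.g. abc-iut-c312-3's content formula). [claim: Mochizuki2012, status: disputed] -/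
theorem negLogTheta_le_sum_add' (Tset : Finset T.VQ) (b : Fin T.lstar → T.VQ → ℝ) {A : ℝ} (hA : 0 ≤ A)
    (hzero : ∀ (i : Fin T.lstar) (vQ : T.VQ), vQ ∉ Tset → P.thetaLocal (labelSucc i) vQ = ((0 : ℝ) : WithTop ℝ))
    (hle : ∀ (i : Fin T.lstar) (vQ : T.VQ), P.thetaLocal (labelSucc i) vQ ≤ ((b i vQ : ℝ) : WithTop ℝ)) :
    P.negLogTheta ≤ ((∑ vQ ∈ Tset, (1 / (T.lstar : ℝ)) * ∑ i : Fin T.lstar, b i vQ + A : ℝ) : WithTop ℝ) :=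
  P.negLogTheta_le_sum_add Tset b hA hzero fun i vQ _ => hle i vQ

end Summit.ABC.IUTFork.Cor312.Setting

end
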